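import Summits.Ventures.PercRepro.S2GiantExactLevels

/-!
# PercRepro — S2: THE GIANT-EXACT COUNT, PART 2 — the count (p8, gen 18; a feeder for S4 — the top of the `q = 7` window)

`ncard_eRk_eq_ncard_le_le_giant_exact`: with the hypotheses of p4 g17's `ncard_eRk_eq_ncard_le_le_giant_quart'` (p8's
unique-giant-flat split with the quartic multiplicity) minus the giant weight condition,
`#{B ⊆ E : r(B) = q, |B| ≤ d} ≤ C(n, q) + σ_m·P_E + 2^{min f (q + d)}` — the non-giant sets through the small and mid pairs
with the mid weight `σ_m = Σ_j C(min(f − q − 1, ν₁ − 2), j)/quart(j + 1)` (`mul_card_levelFNonGiant_le`), the giant sets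
through the powerset of the unique giant flat (`sum_card_levelFGiant_le`), both of Part 1 (S2GiantExactLevels). The proof
is the partition-form proof of Part 1's source with the giant pair count replaced by the powerset bound. At level `7`,
corank `d ≈ p`, the giant term of the old count is `≈ 10^5` times this bound (the row `71` of level `7`). Level-generic.
Axioms: standard.
-/

open scoped Matroid

namespace PercRepro

namespace S2

open Set Finset

variable {α : Type} {M : Matroid α}

set_option maxHeartbeats 800000 in
open scoped Classical in
/-- **THE GIANT-EXACT COUNT** (in `ℚ`): with every circuit of `≥ 3` elements, every rank-`2` set of `≤ 3` points, every
rank-`≤ 3` set of `≤ 6` points, every set of rank `≤ q` of `≤ f` points, every set of rank `≤ q − 1` of `≤ f′` points and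
of nullity `≤ ν_∩`, `|E| = r(M) + d`, `d + ν_∩ < 2ν₁` and `f′ − q ≤ min(f − q − 1, ν₁ − 2)`:
`#{B ⊆ E : r(B) = q, |B| ≤ d} ≤ C(n, q) + σ_m·P_E + 2^{min f (q + d)}`, `σ_m = Σ_{j ≤ d−q−1} C(min(f − q − 1, ν₁ − 2), j)/quart(j + 1)`,
`P_E = Σ_k s_k·C(n, q + 1 − k)` — the non-giant sets by the small and mid pairs with the mid weight, the giant sets by the
powerset of the unique giant flat. -/
theorem ncard_eRk_eq_ncard_le_le_giant_exact (M : Matroid α) [M.Finite] (q f f' ν₁ νi : ℕ) (hq : 1 ≤ q)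
    (hcirc : ∀ C, M.IsCircuit C → 3 ≤ C.encard) (hC1 : ∀ L ⊆ M.E, M.eRk L = 2 → L.ncard ≤ 3)
    (hC2 : ∀ L ⊆ M.E, M.eRk L ≤ 3 → L.ncard ≤ 6)
    (hflat : ∀ X ⊆ M.E, M.eRk X ≤ q → X.ncard ≤ f)
    (hflat' : ∀ X ⊆ M.E, M.eRk X ≤ (q - 1 : ℕ) → X.ncard ≤ f')
    (hinter : ∀ X ⊆ M.E, M.eRk X ≤ (q - 1 : ℕ) → (X.ncard : ℕ∞) ≤ M.eRk X + νi)
    {d : ℕ} (hd : M.E.encard = M.eRank + d) (h2 : d + νi < 2 * ν₁)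
    (hσm : f' - q ≤ min (f - (q + 1)) (ν₁ - 2)) :
    ({B : Set α | B ⊆ M.E ∧ M.eRk B = q ∧ B.ncard ≤ d}.ncard : ℚ) ≤
      (M.E.ncard.choose q : ℚ) +
        (∑ j ∈ Finset.range (d - (q + 1) + 1), ((min (f - (q + 1)) (ν₁ - 2)).choose j : ℚ) / (((j + 1) + 3 * (j + 1).choose 2 + 3 * (j + 1).choose 3 + 2 * (j + 1).choose 4 : ℕ) : ℚ)) *
          (∑ k ∈ Finset.Icc 3 (q + 1),
            ({C | M.IsCircuit C ∧ C.ncard = k}.ncard : ℚ) * (M.E.ncard.choose (q + 1 - k) : ℚ)) +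
        (2 : ℚ) ^ (min f (q + d)) := by
  set Ef := Matroid.groundF M with hEf
  have hE : (Ef : Set α) = M.E := Matroid.coe_groundF M
  have hEcard : Ef.card = M.E.ncard := Matroid.card_groundF M
  set S := {B : Set α | B ⊆ M.E ∧ M.eRk B = q ∧ B.ncard ≤ d} with hS
  set S₁ := {B : Set α | B ⊆ (Ef : Set α) ∧ B.ncard = q} with hS₁
  set S₂ := {B : Set α | B ⊆ M.E ∧ M.eRk B = q ∧ q < B.ncard ∧ B.ncard ≤ d} with hS₂
  have hsplit : S ⊆ S₁ ∪ S₂ := by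
    intro B hB
    have hBfin : B.Finite := M.ground_finite.subset hB.1
    have hle : q ≤ B.ncard := by
      have := M.eRk_le_encard B
      rw [hB.2.1, ← hBfin.cast_ncard_eq] at this
      exact_mod_cast this
    rcases hle.lt_or_eq with h | h
    · exact Or.inr ⟨hB.1, hB.2.1, h, hB.2.2⟩
    · exact Or.inl ⟨by rw [hE]; exact hB.1, h.symm⟩
  have hS₁fin : S₁.Finite := (Ef.finite_toSet.finite_subsets).subset (fun B hB => hB.1)
  have hS₂fin : S₂.Finite := M.ground_finite.finite_subsets.subset (fun B hB => hB.1)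
  have hS₁ : S₁.ncard = M.E.ncard.choose q := by
    rw [hS₁, PercRepro.ncard_subsets_ncard_eq Ef q, hEcard]
  set Ps := (Matroid.pairsSmall M q f').card with hPs
  set Pm := (Matroid.pairsMid M q f' ν₁).card with hPm
  set Fm := min f (q + d) with hFm
  -- the non-giant levels
  have hlevel : ∀ m ∈ Finset.Icc (q + 1) d, ((levelFNonGiant M q f' ν₁ m).card : ℚ) ≤
      ((Ps : ℚ) * ((f' - q).choose (m - (q + 1)) : ℚ) + (Pm : ℚ) * ((min (f - (q + 1)) (ν₁ - 2)).choose (m - (q + 1)) : ℚ)) / (((m - q) + 3 * (m - q).choose 2 + 3 * (m - q).choose 3 + 2 * (m - q).choose 4 : ℕ) : ℚ) := by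
    intro m hm
    rw [Finset.mem_Icc] at hm
    have hmq : 0 < m - q := by omega
    have hpos : (0 : ℚ) < (((m - q) + 3 * (m - q).choose 2 + 3 * (m - q).choose 3 + 2 * (m - q).choose 4 : ℕ) : ℚ) := by
      exact_mod_cast (by omega : 0 < (m - q) + 3 * (m - q).choose 2 + 3 * (m - q).choose 3 + 2 * (m - q).choose 4)
    rw [le_div_iff₀ hpos]
    have h := mul_card_levelFNonGiant_le q f f' ν₁ hq hcirc hC1 hC2 hflat m
    have h' : ((((m - q) + 3 * (m - q).choose 2 + 3 * (m - q).choose 3 + 2 * (m - q).choose 4) * (levelFNonGiant M q f' ν₁ m).card : ℕ) : ℚ) ≤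
        ((Ps * (f' - q).choose (m - (q + 1)) + Pm * (min (f - (q + 1)) (ν₁ - 2)).choose (m - (q + 1)) : ℕ) : ℚ) := by
      exact_mod_cast h
    push_cast at h' ⊢
    linarith
  -- the giant levels
  have hgiant : ((∑ m ∈ Finset.Icc (q + 1) d, (levelFGiant M q f' ν₁ m).card : ℕ) : ℚ) ≤ (2 : ℚ) ^ Fm := by
    have := sum_card_levelFGiant_le q f f' ν₁ νi hq hcirc hC1 hC2 hflat hflat' hinter hd h2
    rw [← hFm] at this
    exact_mod_cast this
  have hS₂q : (S₂.ncard : ℚ) ≤ ∑ m ∈ Finset.Icc (q + 1) d,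
      ((Ps : ℚ) * ((f' - q).choose (m - (q + 1)) : ℚ) + (Pm : ℚ) * ((min (f - (q + 1)) (ν₁ - 2)).choose (m - (q + 1)) : ℚ)) / (((m - q) + 3 * (m - q).choose 2 + 3 * (m - q).choose 3 + 2 * (m - q).choose 4 : ℕ) : ℚ) +
      (2 : ℚ) ^ Fm := by
    calc (S₂.ncard : ℚ) ≤ ((∑ m ∈ Finset.Icc (q + 1) d, (Matroid.levelF M q m).card : ℕ) : ℚ) := by
          exact_mod_cast Matroid.ncard_dep_le_sum_levelF q d
      _ = ((∑ m ∈ Finset.Icc (q + 1) d, (levelFNonGiant M q f' ν₁ m).card : ℕ) : ℚ) +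
          ((∑ m ∈ Finset.Icc (q + 1) d, (levelFGiant M q f' ν₁ m).card : ℕ) : ℚ) := by
          rw [← Nat.cast_add, ← Finset.sum_add_distrib]
          congr 1
          exact Finset.sum_congr rfl (fun m _ => card_levelF_eq_nonGiant_add_giant q f' ν₁ m)
      _ ≤ ∑ m ∈ Finset.Icc (q + 1) d, ((levelFNonGiant M q f' ν₁ m).card : ℚ) + (2 : ℚ) ^ Fm := by
          push_cast
          exact add_le_add le_rfl (by exact_mod_cast hgiant)
      _ ≤ _ := add_le_add (Finset.sum_le_sum hlevel) le_rfl
  have hre : ∑ m ∈ Finset.Icc (q + 1) d,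
      ((Ps : ℚ) * ((f' - q).choose (m - (q + 1)) : ℚ) + (Pm : ℚ) * ((min (f - (q + 1)) (ν₁ - 2)).choose (m - (q + 1)) : ℚ)) / (((m - q) + 3 * (m - q).choose 2 + 3 * (m - q).choose 3 + 2 * (m - q).choose 4 : ℕ) : ℚ) =
      ∑ j ∈ Finset.range (d - q),
      ((Ps : ℚ) * ((f' - q).choose j : ℚ) + (Pm : ℚ) * ((min (f - (q + 1)) (ν₁ - 2)).choose j : ℚ)) / (((j + 1) + 3 * (j + 1).choose 2 + 3 * (j + 1).choose 3 + 2 * (j + 1).choose 4 : ℕ) : ℚ) := by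
    rw [show Finset.Icc (q + 1) d = Finset.image (fun j => q + 1 + j) (Finset.range (d - q)) from ?_]
    · rw [Finset.sum_image (fun a _ b _ h => by omega)]
      apply Finset.sum_congr rfl
      intro j _
      rw [show q + 1 + j - (q + 1) = j by omega, show q + 1 + j - q = j + 1 by omega]
    · ext m
      rw [Finset.mem_Icc, Finset.mem_image]
      constructor
      · intro hm
        exact ⟨m - (q + 1), by rw [Finset.mem_range]; omega, by omega⟩
      · rintro ⟨j, hj, rfl⟩
        rw [Finset.mem_range] at hj
        omega
  have hrange : Finset.range (d - q) ⊆ Finset.range (d - (q + 1) + 1) := Finset.range_mono (by omega)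
  set σs : ℚ := ∑ j ∈ Finset.range (d - (q + 1) + 1), ((f' - q).choose j : ℚ) / (((j + 1) + 3 * (j + 1).choose 2 + 3 * (j + 1).choose 3 + 2 * (j + 1).choose 4 : ℕ) : ℚ) with hσs
  set σm : ℚ := ∑ j ∈ Finset.range (d - (q + 1) + 1), ((min (f - (q + 1)) (ν₁ - 2)).choose j : ℚ) / (((j + 1) + 3 * (j + 1).choose 2 + 3 * (j + 1).choose 3 + 2 * (j + 1).choose 4 : ℕ) : ℚ) with hσmdef
  have hS₂q' : (S₂.ncard : ℚ) ≤ (Ps : ℚ) * σs + (Pm : ℚ) * σm + (2 : ℚ) ^ Fm := by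
    rw [hσs, hσmdef, Finset.mul_sum, Finset.mul_sum, ← Finset.sum_add_distrib]
    refine hS₂q.trans (add_le_add ?_ le_rfl)
    rw [hre]
    refine Finset.sum_le_sum_of_subset_of_nonneg hrange (fun j _ _ => by positivity) |>.trans' ?_
    apply le_of_eq
    apply Finset.sum_congr rfl
    intro j _
    field_simp
  -- the pair counts: `Ps + Pm ≤ #pairsF ≤ P_E`
  have hpart : Ps + Pm ≤ (Matroid.pairsF M q).card := by
    have h1 : (Matroid.pairsSmall M q f').card + (Matroid.pairsBig M q f').card = (Matroid.pairsF M q).card := by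
      unfold Matroid.pairsSmall Matroid.pairsBig
      exact Finset.card_filter_add_card_filter_not _
    have h2 : (Matroid.pairsMid M q f' ν₁).card ≤ (Matroid.pairsBig M q f').card := by
      unfold Matroid.pairsMid
      exact Finset.card_filter_le _ _
    omega
  have hFq : ((Matroid.pairsF M q).card : ℚ) ≤ ∑ k ∈ Finset.Icc 3 (q + 1),
      ({C | M.IsCircuit C ∧ C.ncard = k}.ncard : ℚ) * (M.E.ncard.choose (q + 1 - k) : ℚ) := by
    have h2 := Matroid.card_pairsF_le (M := M) q
    have : (((Matroid.pairsF M q).card : ℕ) : ℚ) ≤ ((∑ k ∈ Finset.Icc 3 (q + 1),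
        {C | M.IsCircuit C ∧ C.ncard = k}.ncard * M.E.ncard.choose (q + 1 - k) : ℕ) : ℚ) := by
      exact_mod_cast h2
    push_cast at this
    exact this
  have hσs0 : (0 : ℚ) ≤ σs := Finset.sum_nonneg (fun j _ => by positivity)
  have hsm : σs ≤ σm := by
    apply Finset.sum_le_sum
    intro j _
    have : (f' - q).choose j ≤ (min (f - (q + 1)) (ν₁ - 2)).choose j := Nat.choose_le_choose j hσm
    have h' : ((f' - q).choose j : ℚ) ≤ ((min (f - (q + 1)) (ν₁ - 2)).choose j : ℚ) := by exact_mod_cast this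
    exact div_le_div_of_nonneg_right h' (by positivity)
  have hSq : (S.ncard : ℚ) ≤ (S₁.ncard : ℚ) + (S₂.ncard : ℚ) := by
    have : S.ncard ≤ S₁.ncard + S₂.ncard :=
      (ncard_le_ncard hsplit (hS₁fin.union hS₂fin)).trans (ncard_union_le _ _)
    exact_mod_cast this
  rw [hS₁] at hSq
  have hpartq : (Ps : ℚ) + Pm ≤ ((Matroid.pairsF M q).card : ℚ) := by exact_mod_cast hpart
  have hPs0 : (0 : ℚ) ≤ Ps := Nat.cast_nonneg _
  have hσm0 : (0 : ℚ) ≤ σm := hσs0.trans hsm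
  have key : (Ps : ℚ) * σs + (Pm : ℚ) * σm ≤ ((Matroid.pairsF M q).card : ℚ) * σm := by
    nlinarith [mul_le_mul_of_nonneg_left hsm hPs0, mul_le_mul_of_nonneg_right hpartq hσm0]
  have e1 := mul_le_mul_of_nonneg_right hFq hσm0
  calc (S.ncard : ℚ) ≤ (M.E.ncard.choose q : ℚ) + (S₂.ncard : ℚ) := hSq
    _ ≤ _ := by linarith only [hS₂q', key, e1, hSq]

end S2

end PercRepro
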